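import Literature.MathematicalPhysics.QuantumLattice.HubbardTTPrimeMultilinearBoxWordAdapters
import Literature.MathematicalPhysics.QuantumLattice.HubbardTTPrimeBoxWordExtension
import Literature.MathematicalPhysics.QuantumLattice.HubbardNNNHoppingEnergyDensityRegionBounds
import Literature.MathematicalPhysics.QuantumLattice.HubbardFillingBoxEnergyBounds
import Literature.MathematicalPhysics.QuantumLattice.HubbardNNNHoppingEnergyDensityParticleHole
import HarnessLib

/-!
# Ventures/CertifiedManyBodySolver — Certificates/HubbardSquare_transportClosure_KitLaws.lean
# (hubbard-fast-reuse-1 g0, cell hubbard-fast, D-0154 (A) CERTIFICATE REUSE: the TRANSPORT-CLOSURE kit, part 2 = the LAWS; part 1 = `…_Kit.lean` = the slices)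

Generic one-step TRANSPORT adapters for the cell's kernel `e₀` words (surrogate-1 `_mlword_Icc` contract: coordinates
`θ = ![U/t, t'/t, n]`, floor/cap = 8 literal coefficients on `[1, θ0, θ1, θ2, θ0θ1, θ0θ2, θ1θ2, θ0θ1θ2]`).
Every adapter takes one or two EXISTING words (cited by name by the consumer files, hypotheses passed through verbatim),
reads them on a coordinate SLICE (a `U`-slice is bilinear in `(t', n)`, an `n`-slice bilinear in `(U, t')`; particle–hole
images `e(t,s,U,n) = e(t,-s,U,2-n) + U(n-1)` folded exactly), applies ONE kernel law of the tree, and returns a literal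
8-coefficient floor/cap on the target cell whose validity against the raw (rational-function) transported bound is checked at
the eight vertices (vertex rule for trilinear forms, `trilinear_nonneg_on_Icc₃`). Laws:
* `tc_mlFloor_Uchord`  — joint concavity in `(t',U)` read along `U` (`energyDensityTT'_ge_convexComb`): floors at `U₀ < U₁` ⇒ floor between;
* `tc_mlCap_Usecx`     — concavity + monotonicity in `U`: cap at `U₁`, floor at `U₀ < U₁` ⇒ cap ABOVE `U₁` with slope `S ≥ (C(U₁)-F(U₀))/(U₁-U₀)`;
* `tc_mlFloor_Umono_above` / `tc_mlCap_Umono_below` — `energyDensityTT'_mono_U` (floors carry up, caps carry down in `U`);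
* `tc_mlCap_nchord`    — convexity in `n` (`energyDensityTT'_le_density_chord_of_mem_Icc`): caps at `n_A < n_B` ⇒ cap between.
Slices: `tc_sliceU_floor/cap`, `tc_sliceN_floor/cap` (direct) and `…_phImage` (through the exact particle–hole map).
HONEST FRAMING: bookkeeping adapters; they certify nothing by themselves; every consumer word inherits exactly the hypotheses of
the words it cites; no number of record; not a phase word; no summit statement is proved here; not a superconductivity verdict.
-/

namespace Summit.Ventures.CertifiedManyBodySolver.Certificates

open Literature.MathematicalPhysics.QuantumLattice
open Literature.MathematicalPhysics.QuantumLattice.ThermodynamicLimit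
open Set

/-! ### §2 One-step transport laws (slice inputs ⇒ literal 8-coefficient output, vertex-checked) -/

/-- **`U`-CHORD FLOOR** (joint concavity of `e₀` in `(t', U)` on `U ≥ 0`, read along `U` at fixed `t'`): bilinear floors
`A(s,n) ≤ e(t,s,U₀,n)` and `B(s,n) ≤ e(t,s,U₁,n)` (`0 ≤ U₀ < U₁`) on the rectangle give, for `U₀ ≤ Ua ≤ θ0 ≤ Ub ≤ U₁`,
`e ≥ ((U₁-θ0)A + (θ0-U₀)B)/(U₁-U₀)`; a literal trilinear form `M` below that chord at the eight vertices of the target cell is a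
floor on the cell (the difference is trilinear). [cite: Israel1979, Thm. I.3.4] -/
theorem tc_mlFloor_Uchord (t : ℝ) {U₀ U₁ Ua Ub s₁ s₂ n₁ n₂ α₀ α₁ α₂ α₃ β₀ β₁ β₂ β₃
    c₀ c₁ c₂ c₃ c₄ c₅ c₆ c₇ : ℝ}
    (hU₀ : 0 ≤ U₀) (hU : U₀ < U₁) (ha : U₀ ≤ Ua) (hb : Ub ≤ U₁) (hn₁ : 0 ≤ n₁) (hn₂ : n₂ < 2)
    (hA : ∀ s n : ℝ, s₁ ≤ s → s ≤ s₂ → n₁ ≤ n → n ≤ n₂ →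
      α₀ + α₁ * s + α₂ * n + α₃ * s * n ≤ energyDensityTT' t s U₀ n)
    (hB : ∀ s n : ℝ, s₁ ≤ s → s ≤ s₂ → n₁ ≤ n → n ≤ n₂ →
      β₀ + β₁ * s + β₂ * n + β₃ * s * n ≤ energyDensityTT' t s U₁ n)
    (v₁₁₁ : (c₀ + c₁ * Ua + c₂ * s₁ + c₃ * n₁ + c₄ * Ua * s₁ + c₅ * Ua * n₁ + c₆ * s₁ * n₁ + c₇ * Ua * s₁ * n₁) * (U₁ - U₀) ≤
      (U₁ - Ua) * (α₀ + α₁ * s₁ + α₂ * n₁ + α₃ * s₁ * n₁) + (Ua - U₀) * (β₀ + β₁ * s₁ + β₂ * n₁ + β₃ * s₁ * n₁))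
    (v₁₁₂ : (c₀ + c₁ * Ua + c₂ * s₁ + c₃ * n₂ + c₄ * Ua * s₁ + c₅ * Ua * n₂ + c₆ * s₁ * n₂ + c₇ * Ua * s₁ * n₂) * (U₁ - U₀) ≤
      (U₁ - Ua) * (α₀ + α₁ * s₁ + α₂ * n₂ + α₃ * s₁ * n₂) + (Ua - U₀) * (β₀ + β₁ * s₁ + β₂ * n₂ + β₃ * s₁ * n₂))
    (v₁₂₁ : (c₀ + c₁ * Ua + c₂ * s₂ + c₃ * n₁ + c₄ * Ua * s₂ + c₅ * Ua * n₁ + c₆ * s₂ * n₁ + c₇ * Ua * s₂ * n₁) * (U₁ - U₀) ≤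
      (U₁ - Ua) * (α₀ + α₁ * s₂ + α₂ * n₁ + α₃ * s₂ * n₁) + (Ua - U₀) * (β₀ + β₁ * s₂ + β₂ * n₁ + β₃ * s₂ * n₁))
    (v₁₂₂ : (c₀ + c₁ * Ua + c₂ * s₂ + c₃ * n₂ + c₄ * Ua * s₂ + c₅ * Ua * n₂ + c₆ * s₂ * n₂ + c₇ * Ua * s₂ * n₂) * (U₁ - U₀) ≤
      (U₁ - Ua) * (α₀ + α₁ * s₂ + α₂ * n₂ + α₃ * s₂ * n₂) + (Ua - U₀) * (β₀ + β₁ * s₂ + β₂ * n₂ + β₃ * s₂ * n₂))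
    (v₂₁₁ : (c₀ + c₁ * Ub + c₂ * s₁ + c₃ * n₁ + c₄ * Ub * s₁ + c₅ * Ub * n₁ + c₆ * s₁ * n₁ + c₇ * Ub * s₁ * n₁) * (U₁ - U₀) ≤
      (U₁ - Ub) * (α₀ + α₁ * s₁ + α₂ * n₁ + α₃ * s₁ * n₁) + (Ub - U₀) * (β₀ + β₁ * s₁ + β₂ * n₁ + β₃ * s₁ * n₁))
    (v₂₁₂ : (c₀ + c₁ * Ub + c₂ * s₁ + c₃ * n₂ + c₄ * Ub * s₁ + c₅ * Ub * n₂ + c₆ * s₁ * n₂ + c₇ * Ub * s₁ * n₂) * (U₁ - U₀) ≤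
      (U₁ - Ub) * (α₀ + α₁ * s₁ + α₂ * n₂ + α₃ * s₁ * n₂) + (Ub - U₀) * (β₀ + β₁ * s₁ + β₂ * n₂ + β₃ * s₁ * n₂))
    (v₂₂₁ : (c₀ + c₁ * Ub + c₂ * s₂ + c₃ * n₁ + c₄ * Ub * s₂ + c₅ * Ub * n₁ + c₆ * s₂ * n₁ + c₇ * Ub * s₂ * n₁) * (U₁ - U₀) ≤
      (U₁ - Ub) * (α₀ + α₁ * s₂ + α₂ * n₁ + α₃ * s₂ * n₁) + (Ub - U₀) * (β₀ + β₁ * s₂ + β₂ * n₁ + β₃ * s₂ * n₁))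
    (v₂₂₂ : (c₀ + c₁ * Ub + c₂ * s₂ + c₃ * n₂ + c₄ * Ub * s₂ + c₅ * Ub * n₂ + c₆ * s₂ * n₂ + c₇ * Ub * s₂ * n₂) * (U₁ - U₀) ≤
      (U₁ - Ub) * (α₀ + α₁ * s₂ + α₂ * n₂ + α₃ * s₂ * n₂) + (Ub - U₀) * (β₀ + β₁ * s₂ + β₂ * n₂ + β₃ * s₂ * n₂)) :
    ∀ θ ∈ Set.Icc (![Ua, s₁, n₁] : Fin 3 → ℝ) ![Ub, s₂, n₂],
      c₀ + c₁ * θ 0 + c₂ * θ 1 + c₃ * θ 2 + c₄ * θ 0 * θ 1 + c₅ * θ 0 * θ 2 + c₆ * θ 1 * θ 2 +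
        c₇ * θ 0 * θ 1 * θ 2 ≤ energyDensityTT' t (θ 1) (θ 0) (θ 2) := by
  intro θ hθ
  obtain ⟨⟨k1, k2⟩, ⟨k3, k4⟩, ⟨k5, k6⟩⟩ := mem_Icc_vec3_iff.1 hθ
  have hn0 : 0 ≤ θ 2 := hn₁.trans k5
  have hn2 : θ 2 < 2 := lt_of_le_of_lt k6 hn₂
  have hA' := hA (θ 1) (θ 2) k3 k4 k5 k6
  have hB' := hB (θ 1) (θ 2) k3 k4 k5 k6
  have hd : 0 < U₁ - U₀ := sub_pos.2 hU
  have hd0 : U₁ - U₀ ≠ 0 := hd.ne'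
  set a : ℝ := (U₁ - θ 0) / (U₁ - U₀) with ha_def
  set b : ℝ := (θ 0 - U₀) / (U₁ - U₀) with hb_def
  have ha0 : 0 ≤ a := div_nonneg (by linarith) hd.le
  have hb0 : 0 ≤ b := div_nonneg (by linarith) hd.le
  have hda : (U₁ - U₀) * a = U₁ - θ 0 := by rw [ha_def]; field_simp
  have hdb : (U₁ - U₀) * b = θ 0 - U₀ := by rw [hb_def]; field_simp
  have hab : a + b = 1 := by
    have h1 : (U₁ - U₀) * (a + b) = (U₁ - U₀) * 1 := by rw [mul_add, hda, hdb]; ring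
    exact mul_left_cancel₀ hd0 h1
  have hc := energyDensityTT'_ge_convexComb t hn0 hn2 hU₀ (hU₀.trans hU.le) ha0 hb0 hab hA' hB'
  have es : a * θ 1 + b * θ 1 = θ 1 := by rw [← add_mul, hab, one_mul]
  have eu : a * U₀ + b * U₁ = θ 0 := by
    have h1 : (U₁ - U₀) * (a * U₀ + b * U₁) = (U₁ - U₀) * θ 0 := by
      rw [mul_add, ← mul_assoc, ← mul_assoc, hda, hdb]; ring
    exact mul_left_cancel₀ hd0 h1
  rw [es, eu] at hc
  have h1 : (U₁ - θ 0) * (α₀ + α₁ * θ 1 + α₂ * θ 2 + α₃ * θ 1 * θ 2) +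
      (θ 0 - U₀) * (β₀ + β₁ * θ 1 + β₂ * θ 2 + β₃ * θ 1 * θ 2) ≤
      (U₁ - U₀) * energyDensityTT' t (θ 1) (θ 0) (θ 2) := by
    have h2 := mul_le_mul_of_nonneg_left hc hd.le
    rw [mul_add, ← mul_assoc, ← mul_assoc, hda, hdb] at h2
    exact h2
  have hv := trilinear_nonneg_on_Icc₃ (a₀ := Ua) (a₁ := s₁) (a₂ := n₁) (b₀ := Ub) (b₁ := s₂) (b₂ := n₂)
    (c₀ := U₁ * α₀ - U₀ * β₀ - (U₁ - U₀) * c₀) (c₁ := -α₀ + β₀ - (U₁ - U₀) * c₁)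
    (c₂ := U₁ * α₁ - U₀ * β₁ - (U₁ - U₀) * c₂) (c₃ := U₁ * α₂ - U₀ * β₂ - (U₁ - U₀) * c₃)
    (c₄ := -α₁ + β₁ - (U₁ - U₀) * c₄) (c₅ := -α₂ + β₂ - (U₁ - U₀) * c₅)
    (c₆ := U₁ * α₃ - U₀ * β₃ - (U₁ - U₀) * c₆) (c₇ := -α₃ + β₃ - (U₁ - U₀) * c₇)
    (by linear_combination v₁₁₁) (by linear_combination v₁₁₂) (by linear_combination v₁₂₁)
    (by linear_combination v₁₂₂) (by linear_combination v₂₁₁) (by linear_combination v₂₁₂)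
    (by linear_combination v₂₂₁) (by linear_combination v₂₂₂) θ hθ
  have h3 : (U₁ - U₀) * (c₀ + c₁ * θ 0 + c₂ * θ 1 + c₃ * θ 2 + c₄ * θ 0 * θ 1 + c₅ * θ 0 * θ 2 +
      c₆ * θ 1 * θ 2 + c₇ * θ 0 * θ 1 * θ 2) ≤ (U₁ - U₀) * energyDensityTT' t (θ 1) (θ 0) (θ 2) := by
    linear_combination h1 + hv
  exact le_of_mul_le_mul_left h3 hd

/-- **`U`-SECANT-EXTENSION CAP** (concavity + monotonicity of `e₀` in `U`): a bilinear floor `A ≤ e(·,U₀,·)` and a bilinear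
cap `e(·,U₁,·) ≤ B` with `0 ≤ U₀ < U₁` bound the right slope at `U₁` by `(B-A)/(U₁-U₀) ≤ S` (four corner checks),
whence `e(θ) ≤ B(θ1,θ2) + (θ0-U₁)S` for `θ0 ≥ U₁`: a cap in the 8-coefficient shape. [cite: BachLiebSolovej1994, eq. (2c.36)] -/
theorem tc_mlCap_Usecx (t : ℝ) {U₀ U₁ Ua Ub s₁ s₂ n₁ n₂ S α₀ α₁ α₂ α₃ β₀ β₁ β₂ β₃ : ℝ}
    (hU₀ : 0 ≤ U₀) (hU : U₀ < U₁) (ha : U₁ ≤ Ua) (hn₁ : 0 ≤ n₁) (hn₂ : n₂ < 2)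
    (hA : ∀ s n : ℝ, s₁ ≤ s → s ≤ s₂ → n₁ ≤ n → n ≤ n₂ →
      α₀ + α₁ * s + α₂ * n + α₃ * s * n ≤ energyDensityTT' t s U₀ n)
    (hB : ∀ s n : ℝ, s₁ ≤ s → s ≤ s₂ → n₁ ≤ n → n ≤ n₂ →
      energyDensityTT' t s U₁ n ≤ β₀ + β₁ * s + β₂ * n + β₃ * s * n)
    (w₁₁ : (β₀ + β₁ * s₁ + β₂ * n₁ + β₃ * s₁ * n₁) - (α₀ + α₁ * s₁ + α₂ * n₁ + α₃ * s₁ * n₁) ≤ (U₁ - U₀) * S)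
    (w₁₂ : (β₀ + β₁ * s₁ + β₂ * n₂ + β₃ * s₁ * n₂) - (α₀ + α₁ * s₁ + α₂ * n₂ + α₃ * s₁ * n₂) ≤ (U₁ - U₀) * S)
    (w₂₁ : (β₀ + β₁ * s₂ + β₂ * n₁ + β₃ * s₂ * n₁) - (α₀ + α₁ * s₂ + α₂ * n₁ + α₃ * s₂ * n₁) ≤ (U₁ - U₀) * S)
    (w₂₂ : (β₀ + β₁ * s₂ + β₂ * n₂ + β₃ * s₂ * n₂) - (α₀ + α₁ * s₂ + α₂ * n₂ + α₃ * s₂ * n₂) ≤ (U₁ - U₀) * S) :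
    ∀ θ ∈ Set.Icc (![Ua, s₁, n₁] : Fin 3 → ℝ) ![Ub, s₂, n₂],
      energyDensityTT' t (θ 1) (θ 0) (θ 2) ≤ (β₀ - U₁ * S) + S * θ 0 + β₁ * θ 1 + β₂ * θ 2 + 0 * θ 0 * θ 1 +
        0 * θ 0 * θ 2 + β₃ * θ 1 * θ 2 + 0 * θ 0 * θ 1 * θ 2 := by
  intro θ hθ
  obtain ⟨⟨k1, _⟩, ⟨k3, k4⟩, ⟨k5, k6⟩⟩ := mem_Icc_vec3_iff.1 hθ
  have hn0 : 0 ≤ θ 2 := hn₁.trans k5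
  have hn2 : θ 2 < 2 := lt_of_le_of_lt k6 hn₂
  have hA' := hA (θ 1) (θ 2) k3 k4 k5 k6
  have hB' := hB (θ 1) (θ 2) k3 k4 k5 k6
  have hw : 0 ≤ ((U₁ - U₀) * S - (β₀ - α₀)) + (-(β₁ - α₁)) * θ 1 + (-(β₂ - α₂)) * θ 2 +
      (-(β₃ - α₃)) * θ 1 * θ 2 :=
    bilinear_nonneg_on_rect k3 k4 k5 k6 (by linear_combination w₁₁) (by linear_combination w₁₂)
      (by linear_combination w₂₁) (by linear_combination w₂₂)
  rcases eq_or_lt_of_le (ha.trans k1) with h0 | h0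
  · rw [← h0]
    linear_combination hB'
  · have hd : 0 < θ 0 - U₀ := by linarith
    have hd0 : θ 0 - U₀ ≠ 0 := hd.ne'
    set a : ℝ := (θ 0 - U₁) / (θ 0 - U₀) with ha_def
    set b : ℝ := (U₁ - U₀) / (θ 0 - U₀) with hb_def
    have ha0 : 0 ≤ a := div_nonneg (by linarith) hd.le
    have hb0 : 0 ≤ b := div_nonneg (by linarith) hd.le
    have hda : (θ 0 - U₀) * a = θ 0 - U₁ := by rw [ha_def]; field_simp
    have hdb : (θ 0 - U₀) * b = U₁ - U₀ := by rw [hb_def]; field_simp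
    have hab : a + b = 1 := by
      have h1 : (θ 0 - U₀) * (a + b) = (θ 0 - U₀) * 1 := by rw [mul_add, hda, hdb]; ring
      exact mul_left_cancel₀ hd0 h1
    have hc := energyDensityTT'_ge_convexComb t hn0 hn2 hU₀ (by linarith : (0 : ℝ) ≤ θ 0) ha0 hb0 hab hA'
      (le_refl (energyDensityTT' t (θ 1) (θ 0) (θ 2)))
    have es : a * θ 1 + b * θ 1 = θ 1 := by rw [← add_mul, hab, one_mul]
    have eu : a * U₀ + b * θ 0 = U₁ := by
      have h1 : (θ 0 - U₀) * (a * U₀ + b * θ 0) = (θ 0 - U₀) * U₁ := by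
        rw [mul_add, ← mul_assoc, ← mul_assoc, hda, hdb]; ring
      exact mul_left_cancel₀ hd0 h1
    rw [es, eu] at hc
    have h1 := hc.trans hB'
    have h2 : (θ 0 - U₁) * (α₀ + α₁ * θ 1 + α₂ * θ 2 + α₃ * θ 1 * θ 2) +
        (U₁ - U₀) * energyDensityTT' t (θ 1) (θ 0) (θ 2) ≤
        (θ 0 - U₀) * (β₀ + β₁ * θ 1 + β₂ * θ 2 + β₃ * θ 1 * θ 2) := by
      have h3 := mul_le_mul_of_nonneg_left h1 hd.le
      rw [mul_add, ← mul_assoc, ← mul_assoc, hda, hdb] at h3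
      exact h3
    have h3 : (θ 0 - U₁) * ((β₀ + β₁ * θ 1 + β₂ * θ 2 + β₃ * θ 1 * θ 2) -
        (α₀ + α₁ * θ 1 + α₂ * θ 2 + α₃ * θ 1 * θ 2)) ≤ (θ 0 - U₁) * ((U₁ - U₀) * S) :=
      mul_le_mul_of_nonneg_left (by linear_combination hw) (by linarith)
    have hdU : 0 < U₁ - U₀ := sub_pos.2 hU
    have h4 : (U₁ - U₀) * energyDensityTT' t (θ 1) (θ 0) (θ 2) ≤
        (U₁ - U₀) * ((β₀ - U₁ * S) + S * θ 0 + β₁ * θ 1 + β₂ * θ 2 + 0 * θ 0 * θ 1 +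
          0 * θ 0 * θ 2 + β₃ * θ 1 * θ 2 + 0 * θ 0 * θ 1 * θ 2) := by
      linear_combination h2 + h3
    exact le_of_mul_le_mul_left h4 hdU

/-- **FLOOR CARRIED UP IN `U`** (`energyDensityTT'_mono_U`): a bilinear floor at `U₀ ≥ 0` floors every `θ0 ≥ U₀`.
[cite: BachLiebSolovej1994, eq. (2c.36)] -/
theorem tc_mlFloor_Umono_above (t : ℝ) {U₀ Ua Ub s₁ s₂ n₁ n₂ α₀ α₁ α₂ α₃ : ℝ}
    (hU₀ : 0 ≤ U₀) (ha : U₀ ≤ Ua) (hn₁ : 0 ≤ n₁) (hn₂ : n₂ < 2)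
    (hA : ∀ s n : ℝ, s₁ ≤ s → s ≤ s₂ → n₁ ≤ n → n ≤ n₂ →
      α₀ + α₁ * s + α₂ * n + α₃ * s * n ≤ energyDensityTT' t s U₀ n) :
    ∀ θ ∈ Set.Icc (![Ua, s₁, n₁] : Fin 3 → ℝ) ![Ub, s₂, n₂],
      α₀ + 0 * θ 0 + α₁ * θ 1 + α₂ * θ 2 + 0 * θ 0 * θ 1 + 0 * θ 0 * θ 2 + α₃ * θ 1 * θ 2 +
        0 * θ 0 * θ 1 * θ 2 ≤ energyDensityTT' t (θ 1) (θ 0) (θ 2) := by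
  intro θ hθ
  obtain ⟨⟨k1, _⟩, ⟨k3, k4⟩, ⟨k5, k6⟩⟩ := mem_Icc_vec3_iff.1 hθ
  have hA' := hA (θ 1) (θ 2) k3 k4 k5 k6
  have hm := energyDensityTT'_mono_U t (θ 1) (hn₁.trans k5) (lt_of_le_of_lt k6 hn₂) hU₀ (ha.trans k1)
  linear_combination hA' + hm

/-- **CAP CARRIED DOWN IN `U`** (`energyDensityTT'_mono_U`): a bilinear cap at `U₁` caps every `0 ≤ θ0 ≤ U₁`.
[cite: BachLiebSolovej1994, eq. (2c.36)] -/
theorem tc_mlCap_Umono_below (t : ℝ) {U₁ Ua Ub s₁ s₂ n₁ n₂ β₀ β₁ β₂ β₃ : ℝ}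
    (hUa : 0 ≤ Ua) (hb : Ub ≤ U₁) (hn₁ : 0 ≤ n₁) (hn₂ : n₂ < 2)
    (hB : ∀ s n : ℝ, s₁ ≤ s → s ≤ s₂ → n₁ ≤ n → n ≤ n₂ →
      energyDensityTT' t s U₁ n ≤ β₀ + β₁ * s + β₂ * n + β₃ * s * n) :
    ∀ θ ∈ Set.Icc (![Ua, s₁, n₁] : Fin 3 → ℝ) ![Ub, s₂, n₂],
      energyDensityTT' t (θ 1) (θ 0) (θ 2) ≤ β₀ + 0 * θ 0 + β₁ * θ 1 + β₂ * θ 2 + 0 * θ 0 * θ 1 +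
        0 * θ 0 * θ 2 + β₃ * θ 1 * θ 2 + 0 * θ 0 * θ 1 * θ 2 := by
  intro θ hθ
  obtain ⟨⟨k1, k2⟩, ⟨k3, k4⟩, ⟨k5, k6⟩⟩ := mem_Icc_vec3_iff.1 hθ
  have hB' := hB (θ 1) (θ 2) k3 k4 k5 k6
  have hm := energyDensityTT'_mono_U t (θ 1) (hn₁.trans k5) (lt_of_le_of_lt k6 hn₂) (hUa.trans k1) (k2.trans hb)
  linear_combination hB' + hm

/-- **DENSITY-CHORD CAP** (convexity of `e₀` in `n`): bilinear caps `e(·,·,n_A) ≤ A(U,s)` and `e(·,·,n_B) ≤ B(U,s)`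
(`0 ≤ n_A < n_B < 2`) on `U ∈ [Ua,Ub]` (`Ua ≥ 0`), `s ∈ [s₁,s₂]` give `e ≤ ((n_B-θ2)A + (θ2-n_A)B)/(n_B-n_A)` for
`n_A ≤ na ≤ θ2 ≤ nb ≤ n_B`; a literal trilinear form above that chord at the eight vertices caps the cell.
[cite: LiebWuPhysicaA2003, §7] -/
theorem tc_mlCap_nchord (t : ℝ) {nA nB Ua Ub s₁ s₂ na nb α₀ α₁ α₂ α₃ β₀ β₁ β₂ β₃
    c₀ c₁ c₂ c₃ c₄ c₅ c₆ c₇ : ℝ}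
    (hUa : 0 ≤ Ua) (hnA : 0 ≤ nA) (hn : nA < nB) (hnB : nB < 2) (ha : nA ≤ na) (hb : nb ≤ nB)
    (hA : ∀ U s : ℝ, Ua ≤ U → U ≤ Ub → s₁ ≤ s → s ≤ s₂ →
      energyDensityTT' t s U nA ≤ α₀ + α₁ * U + α₂ * s + α₃ * U * s)
    (hB : ∀ U s : ℝ, Ua ≤ U → U ≤ Ub → s₁ ≤ s → s ≤ s₂ →
      energyDensityTT' t s U nB ≤ β₀ + β₁ * U + β₂ * s + β₃ * U * s)
    (v₁₁₁ : (nB - na) * (α₀ + α₁ * Ua + α₂ * s₁ + α₃ * Ua * s₁) + (na - nA) * (β₀ + β₁ * Ua + β₂ * s₁ + β₃ * Ua * s₁) ≤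
      (nB - nA) * (c₀ + c₁ * Ua + c₂ * s₁ + c₃ * na + c₄ * Ua * s₁ + c₅ * Ua * na + c₆ * s₁ * na + c₇ * Ua * s₁ * na))
    (v₁₁₂ : (nB - nb) * (α₀ + α₁ * Ua + α₂ * s₁ + α₃ * Ua * s₁) + (nb - nA) * (β₀ + β₁ * Ua + β₂ * s₁ + β₃ * Ua * s₁) ≤
      (nB - nA) * (c₀ + c₁ * Ua + c₂ * s₁ + c₃ * nb + c₄ * Ua * s₁ + c₅ * Ua * nb + c₆ * s₁ * nb + c₇ * Ua * s₁ * nb))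
    (v₁₂₁ : (nB - na) * (α₀ + α₁ * Ua + α₂ * s₂ + α₃ * Ua * s₂) + (na - nA) * (β₀ + β₁ * Ua + β₂ * s₂ + β₃ * Ua * s₂) ≤
      (nB - nA) * (c₀ + c₁ * Ua + c₂ * s₂ + c₃ * na + c₄ * Ua * s₂ + c₅ * Ua * na + c₆ * s₂ * na + c₇ * Ua * s₂ * na))
    (v₁₂₂ : (nB - nb) * (α₀ + α₁ * Ua + α₂ * s₂ + α₃ * Ua * s₂) + (nb - nA) * (β₀ + β₁ * Ua + β₂ * s₂ + β₃ * Ua * s₂) ≤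
      (nB - nA) * (c₀ + c₁ * Ua + c₂ * s₂ + c₃ * nb + c₄ * Ua * s₂ + c₅ * Ua * nb + c₆ * s₂ * nb + c₇ * Ua * s₂ * nb))
    (v₂₁₁ : (nB - na) * (α₀ + α₁ * Ub + α₂ * s₁ + α₃ * Ub * s₁) + (na - nA) * (β₀ + β₁ * Ub + β₂ * s₁ + β₃ * Ub * s₁) ≤
      (nB - nA) * (c₀ + c₁ * Ub + c₂ * s₁ + c₃ * na + c₄ * Ub * s₁ + c₅ * Ub * na + c₆ * s₁ * na + c₇ * Ub * s₁ * na))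
    (v₂₁₂ : (nB - nb) * (α₀ + α₁ * Ub + α₂ * s₁ + α₃ * Ub * s₁) + (nb - nA) * (β₀ + β₁ * Ub + β₂ * s₁ + β₃ * Ub * s₁) ≤
      (nB - nA) * (c₀ + c₁ * Ub + c₂ * s₁ + c₃ * nb + c₄ * Ub * s₁ + c₅ * Ub * nb + c₆ * s₁ * nb + c₇ * Ub * s₁ * nb))
    (v₂₂₁ : (nB - na) * (α₀ + α₁ * Ub + α₂ * s₂ + α₃ * Ub * s₂) + (na - nA) * (β₀ + β₁ * Ub + β₂ * s₂ + β₃ * Ub * s₂) ≤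
      (nB - nA) * (c₀ + c₁ * Ub + c₂ * s₂ + c₃ * na + c₄ * Ub * s₂ + c₅ * Ub * na + c₆ * s₂ * na + c₇ * Ub * s₂ * na))
    (v₂₂₂ : (nB - nb) * (α₀ + α₁ * Ub + α₂ * s₂ + α₃ * Ub * s₂) + (nb - nA) * (β₀ + β₁ * Ub + β₂ * s₂ + β₃ * Ub * s₂) ≤
      (nB - nA) * (c₀ + c₁ * Ub + c₂ * s₂ + c₃ * nb + c₄ * Ub * s₂ + c₅ * Ub * nb + c₆ * s₂ * nb + c₇ * Ub * s₂ * nb)) :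
    ∀ θ ∈ Set.Icc (![Ua, s₁, na] : Fin 3 → ℝ) ![Ub, s₂, nb],
      energyDensityTT' t (θ 1) (θ 0) (θ 2) ≤ c₀ + c₁ * θ 0 + c₂ * θ 1 + c₃ * θ 2 + c₄ * θ 0 * θ 1 +
        c₅ * θ 0 * θ 2 + c₆ * θ 1 * θ 2 + c₇ * θ 0 * θ 1 * θ 2 := by
  intro θ hθ
  obtain ⟨⟨k1, k2⟩, ⟨k3, k4⟩, ⟨k5, k6⟩⟩ := mem_Icc_vec3_iff.1 hθ
  have hU0 : 0 ≤ θ 0 := hUa.trans k1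
  have hA' := hA (θ 0) (θ 1) k1 k2 k3 k4
  have hB' := hB (θ 0) (θ 1) k1 k2 k3 k4
  have hd : 0 < nB - nA := sub_pos.2 hn
  have hch := energyDensityTT'_le_density_chord_of_mem_Icc t (θ 1) hU0 hnA hn hnB hA' hB'
    (n := θ 2) ⟨ha.trans k5, k6.trans hb⟩
  rw [le_div_iff₀ hd] at hch
  have hv := trilinear_nonneg_on_Icc₃ (a₀ := Ua) (a₁ := s₁) (a₂ := na) (b₀ := Ub) (b₁ := s₂) (b₂ := nb)
    (c₀ := (nB - nA) * c₀ - (nB * α₀ - nA * β₀)) (c₁ := (nB - nA) * c₁ - (nB * α₁ - nA * β₁))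
    (c₂ := (nB - nA) * c₂ - (nB * α₂ - nA * β₂)) (c₃ := (nB - nA) * c₃ - (-α₀ + β₀))
    (c₄ := (nB - nA) * c₄ - (nB * α₃ - nA * β₃)) (c₅ := (nB - nA) * c₅ - (-α₁ + β₁))
    (c₆ := (nB - nA) * c₆ - (-α₂ + β₂)) (c₇ := (nB - nA) * c₇ - (-α₃ + β₃))
    (by linear_combination v₁₁₁) (by linear_combination v₁₁₂) (by linear_combination v₁₂₁)
    (by linear_combination v₁₂₂) (by linear_combination v₂₁₁) (by linear_combination v₂₁₂)
    (by linear_combination v₂₂₁) (by linear_combination v₂₂₂) θ hθ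
  have h3 : energyDensityTT' t (θ 1) (θ 0) (θ 2) * (nB - nA) ≤ (c₀ + c₁ * θ 0 + c₂ * θ 1 + c₃ * θ 2 + c₄ * θ 0 * θ 1 +
      c₅ * θ 0 * θ 2 + c₆ * θ 1 * θ 2 + c₇ * θ 0 * θ 1 * θ 2) * (nB - nA) := by
    linear_combination hch + hv
  exact le_of_mul_le_mul_right h3 hd

end Summit.Ventures.CertifiedManyBodySolver.Certificates
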